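import Literature.AlgebraicGeometry.Frobenioids.PsiBaseEquivalence
import Literature.AlgebraicGeometry.Frobenioids.BaseEquivalencePreserved
import HarnessLib

/-!
# Frobenioids I, Theorem 3.4 (v): the conclusion, from Theorem 3.4 (iii) and slimness

Mochizuki, *The geometry of Frobenioids I: the general theory*, Kyushu J. Math. **62** (2008)
293–400, Thm. 3.4 (v) p. 63 ll. 22–37 [cite: MochizukiFrdI2008, Thm. 3.4 (v) p.63]:

> "(v) Suppose that: (a) `C_1`, `C_2` are of standard type; (b) if `C_1`, `C_2` are of group-like
> type, then both `Ψ` and some quasi-inverse to `Ψ` preserve base-isomorphisms; (c) `D_1`, `D_2` are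
> slim. Then `Ψ` preserves the base-identity endomorphisms and base-equivalent pairs of co-objective
> morphisms. Moreover, there exists a 1-unique functor `Ψ^Base : D_1 → D_2` that fits into a
> 1-commutative diagram … Finally, each of the composite functors of this diagram is rigid."

PROOF-ONLY capstone (seat abc-iut-L1-d4 gen 2; assembly L00 of the (v)-rows L12–L14 of
plan/L1/SUBDAG-FrdI-Thm34.md): the full CONCLUSION of abc-iut-L1-t3's typed
`PreFrobenioidData.Thm34v` — all three conjuncts — for Frobenioids `C₁, C₂` over SLIM `D₁, D₂`, from the
single input that `Ψ` and `Ψ⁻¹` carry base-isomorphisms to base-isomorphisms (which is what hypotheses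
(a), (b) deliver through Thm. 3.4 (iii); discharged by abc-iut-L1-t13 over FSM-type bases):
`baseEquivalent_map_of_isSlim` (L12) feeds the hypotheses `hbe`, `hbe'`
of `exists_oneUniqueSquare_base` (L13, L14). Nothing of [FrdI] is restated.
-/

namespace Literature.AlgebraicGeometry.Frobenioids

open CategoryTheory Opposite

universe w v v' u u'

namespace PreFrobenioid

variable {D₁ : Type u} [Category.{v} D₁] {Φ₁ : D₁ᵒᵖ ⥤ CommMonCat.{w}} {C₁ : Type u'} [Category.{v'} C₁]
  {D₂ : Type u} [Category.{v} D₂] {Φ₂ : D₂ᵒᵖ ⥤ CommMonCat.{w}} {C₂ : Type u'} [Category.{v'} C₂]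
  {F₁ : C₁ ⥤ ElemFrobenioid Φ₁} {F₂ : C₂ ⥤ ElemFrobenioid Φ₂}

/-- **[FrdI] Thm. 3.4 (v) — the conclusion, for Frobenioids over slim bases, from Thm. 3.4 (iii)**: if
`Ψ : C₁ ⥲ C₂` and `Ψ⁻¹` carry base-isomorphisms to base-isomorphisms and `D₁`, `D₂` are slim, then
`Ψ` preserves base-identity endomorphisms and base-equivalent pairs, and there is a `1`-unique
`Ψ^Base : D₁ ⥤ D₂` `1`-commuting with `Ψ` over the base functors, both composites of the square being
rigid — literally the conclusion of abc-iut-L1-t3's `PreFrobenioidData.Thm34v`.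
[cite: MochizukiFrdI2008, Thm. 3.4 (v) p.63] -/
theorem thm34v_conclusion_of_preserves_baseIso (hF₁ : IsFrobenioid F₁) (hF₂ : IsFrobenioid F₂)
    (Ψ : C₁ ≌ C₂) (hslim₁ : IsSlim D₁) (hslim₂ : IsSlim D₂)
    (hbiso : ∀ ⦃X Y : C₁⦄ (f : X ⟶ Y), IsIso (Base F₁ f) → IsIso (Base F₂ (Ψ.functor.map f)))
    (hbiso' : ∀ ⦃X Y : C₂⦄ (f : X ⟶ Y), IsIso (Base F₂ f) → IsIso (Base F₁ (Ψ.inverse.map f))) :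
    (∀ (A : C₁) (α : A ⟶ A), (PreFrobenioidData.ofFunctor Φ₁ F₁).IsBaseIdentity α →
        (PreFrobenioidData.ofFunctor Φ₂ F₂).IsBaseIdentity (Ψ.functor.map α)) ∧
      PreFrobenioidData.PreservesRel Ψ.functor
        (fun ⦃_ _⦄ φ ψ => (PreFrobenioidData.ofFunctor Φ₁ F₁).BaseEquivalent φ ψ)
        (fun ⦃_ _⦄ φ ψ => (PreFrobenioidData.ofFunctor Φ₂ F₂).BaseEquivalent φ ψ) ∧
      ∃ ΨBase : D₁ ⥤ D₂,
        PreFrobenioidData.OneUniqueSquare Ψ.functor (PreFrobenioidData.ofFunctor Φ₁ F₁).base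
          (PreFrobenioidData.ofFunctor Φ₂ F₂).base ΨBase ∧
        IsRigidFunctor (Ψ.functor ⋙ (PreFrobenioidData.ofFunctor Φ₂ F₂).base) ∧
        IsRigidFunctor ((PreFrobenioidData.ofFunctor Φ₁ F₁).base ⋙ ΨBase) := by
  have hbe : ∀ ⦃A B : C₁⦄ (φ ψ : A ⟶ B), BaseEquivalent F₁ φ ψ →
      BaseEquivalent F₂ (Ψ.functor.map φ) (Ψ.functor.map ψ) :=
    fun A B φ ψ h => baseEquivalent_map_of_isSlim hF₁ hF₂ Ψ hslim₂ hbiso h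
  have hbe' : ∀ ⦃A B : C₂⦄ (φ ψ : A ⟶ B), BaseEquivalent F₂ φ ψ →
      BaseEquivalent F₁ (Ψ.inverse.map φ) (Ψ.inverse.map ψ) :=
    fun A B φ ψ h => baseEquivalent_map_of_isSlim hF₂ hF₁ Ψ.symm hslim₁ hbiso' h
  refine ⟨fun A α hα => ?_, hbe, ?_⟩
  · -- base-identity endomorphisms: the pair `(α, id)`
    have h' : BaseEquivalent F₁ α (𝟙 A) := by
      change Base F₁ α = Base F₁ (𝟙 A)
      rw [base_id]
      exact hα
    have := hbe α (𝟙 A) h'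
    change Base F₂ (Ψ.functor.map α) = 𝟙 _
    unfold BaseEquivalent at this
    rw [this, CategoryTheory.Functor.map_id, base_id]
  exact exists_oneUniqueSquare_base hF₁ hF₂ Ψ (fun B A α hα => hbiso α hα.2) hbe
    (fun B A α hα => hbiso' α hα.2) hbe' hslim₂

end PreFrobenioid

end Literature.AlgebraicGeometry.Frobenioids
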